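import Summits.PneNP.PneNP.Theorems.OneSliceSliceTargetFibreCliqueLowerAux
import Summits.PneNP.PneNP.Theorems.OneSliceConstantBandTransferStepAux
import Summits.PneNP.PneNP.Theorems.SingleThreshold.Negative.Independence
import Summits.PneNP.PneNP.Theorems.SliceACZero.Negative.WindowDepth
import Summits.PneNP.PneNP.Theorems.SliceACZero.Negative.DeltaBeforeK
import Literature.Computability.Complexity.CliqueThresholdBounds
import Literature.Computability.Complexity.RossmanMonotoneCliqueGraphs
import Literature.Computability.Complexity.RossmanMonotoneCliqueLemma23Proofs

/-!
# Route OneSlice, crux `SliceTarget` (stmt-PneNP-2832), line `Sketch-ideator3-r1`: stub T3 `FibreCliqueLower`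
# (slice second moment on a fibre)

For `k ≥ 4` there is `α = α(k) > 0` such that eventually in `n`, on every central slice `j` of the critical window, for every
slot set `F` with `#F ≤ 3n` and every pattern `ρ`, at least an `α`-fraction of the fibre `{x ∈ slice_j : x|_F = ρ|_F}` consists
of graphs with a `k`-clique avoiding `F`. This is the lower fibre bound feeding the locality floor `sliceLB_of_locality`
(`Theorems/OneSliceSliceTargetTransfer.lean`) at `k = 4`, i.e. the exponents `c ≤ 1` of the crux. Proof: the free part of the
fibre is a uniform layer of `Fᶜ` of density in `[p/2, 4p]`, `p = n^{-2/(k-1)}` (window bookkeeping `fcl_window`, `#F ≤ 3n = o(C(n,2)p)`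
for `k ≥ 4`); the `k`-sets with all clique edges off `F` number `≥ C(n,k) − 3n·C(n−2,k−2)`; second moment on the layer
(`fcl_layer_bound`, from the generic counting of `…FibreCliqueLowerAux`). Worker of lead prover-line-stmt-PneNP-2832-0 (wave 1,
2026-08-16); landed by lead -1 once the Aux module was built.
-/

set_option linter.dupNamespace false

namespace Summit.PneNP.PneNP.Cruxes.SliceTarget.Ideator3Line

open Literature.Computability.Complexity Finset Filter Classical
open scoped Topology
open Summit.PneNP.PneNP.Theorems.ConstantBand.Negative (Edge thr Central slice)
open Summit.PneNP.PneNP.Theorems.SingleThreshold.Negative (Edges zeroOn pc pc_nonneg pc_le_one tendsto_pc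
  pc_pow_choose)
open Summit.PneNP.PneNP.Theorems.SliceACZero.Negative (sliceCard sliceCard_eq card_slice_supset_le
  choose_sub_mul_pow_le_choose_mul_pow card_supp supp_injective supp_indicator mem_supp)
open Summit.PneNP.PneNP.Theorems.SliceACZero.Negative renaming supp → esupp
open Summit.PneNP.PneNP.Cruxes.ConstantBand.FlatPriorRelativeMinterms (ts_tendsto_T ts_tendsto_lower
  ts_tendsto_upper ts_central_iff ts_T_mul_lower_le ts_le_T_mul_upper)

noncomputable section

/-- **Second moment on a layer.** For a slot set `V`, a family `𝒜'` of `k`-sets whose clique edge sets lie in `V`, and the layer of `m`-subsets of `V` (`C(k,2) ≤ m`, `m/|V| ≤ b·p`): `(#𝒜' · C(|V|−K, m−K))² ≤ #{y : some A ∈ 𝒜' has K_A ⊆ y} · #𝒜' · C(|V|,m) · (m/|V|)^K · (1 + k·2^k·b^K)` — Cauchy–Schwarz (`fcl_sq_sum_card_le`) against the pair sum bounded by `fcl_sum_pow_card_union_le`. [folklore] -/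
theorem fcl_layer_bound {n k m : ℕ} (hk : 2 ≤ k) (hn : 1 ≤ n) (V : Finset (Edge n))
    (𝒜' : Finset (Finset (Fin n)))
    (h𝒜' : ∀ A ∈ 𝒜', A ∈ powersetCard k (univ : Finset (Fin n)) ∧
      (univ.filter fun e : Edge n => cliqueVec A e = true) ⊆ V)
    (hV : 0 < #V) (hKm : k.choose 2 ≤ m) {b : ℝ} (hb : 1 ≤ b) (hqb : (m : ℝ) / #V ≤ b * pc n k) :
    ((#𝒜' : ℝ) * ((#V - k.choose 2).choose (m - k.choose 2) : ℝ)) ^ 2 ≤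
      #((V.powersetCard m).filter fun y =>
          ∃ A ∈ 𝒜', (univ.filter fun e : Edge n => cliqueVec A e = true) ⊆ y) *
        ((#𝒜' : ℝ) * ((#V).choose m : ℝ) * (((m : ℝ) / #V) ^ k.choose 2 * (1 + k * 2 ^ k * b ^ k.choose 2))) := by
  have hq0 : 0 ≤ (m : ℝ) / #V := by positivity
  have h3 := fcl_sq_sum_card_le (V.powersetCard m) 𝒜' fun A => univ.filter fun e : Edge n => cliqueVec A e = true
  have hterm : ∀ A ∈ 𝒜', (#((V.powersetCard m).filter fun y =>
      (univ.filter fun e : Edge n => cliqueVec A e = true) ⊆ y) : ℝ) =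
      ((#V - k.choose 2).choose (m - k.choose 2) : ℝ) := by
    intro A hA
    have hSk : #(univ.filter fun e : Edge n => cliqueVec A e = true) = k.choose 2 := by
      rw [card_filter_cliqueVec, (mem_powersetCard.1 (h𝒜' A hA).1).2]
    rw [card_filter_powersetCard_subset _ V m (h𝒜' A hA).2 (hSk.le.trans hKm), hSk]
  have hsum1 : ∑ A ∈ 𝒜', (#((V.powersetCard m).filter fun y =>
      (univ.filter fun e : Edge n => cliqueVec A e = true) ⊆ y) : ℝ) =
      #𝒜' * ((#V - k.choose 2).choose (m - k.choose 2) : ℝ) := by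
    rw [sum_congr rfl hterm, sum_const, nsmul_eq_mul]
  have hsum2 : ∑ A ∈ 𝒜', ∑ B ∈ 𝒜', (#((V.powersetCard m).filter fun y =>
      (univ.filter fun e : Edge n => cliqueVec A e = true) ∪
        (univ.filter fun e : Edge n => cliqueVec B e = true) ⊆ y) : ℝ) ≤
      #𝒜' * ((#V).choose m : ℝ) * (((m : ℝ) / #V) ^ k.choose 2 * (1 + k * 2 ^ k * b ^ k.choose 2)) := by
    calc _ ≤ ∑ A ∈ 𝒜', ∑ B ∈ 𝒜', ((#V).choose m : ℝ) * ((m : ℝ) / #V) ^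
          #((univ.filter fun e : Edge n => cliqueVec A e = true) ∪
            (univ.filter fun e : Edge n => cliqueVec B e = true)) :=
          sum_le_sum fun A hA => sum_le_sum fun B hB =>
            fcl_card_filter_supset_le V _ m (union_subset (h𝒜' A hA).2 (h𝒜' B hB).2) hV
      _ = ∑ A ∈ 𝒜', ((#V).choose m : ℝ) * ∑ B ∈ 𝒜', ((m : ℝ) / #V) ^
          #((univ.filter fun e : Edge n => cliqueVec A e = true) ∪
            (univ.filter fun e : Edge n => cliqueVec B e = true)) := by
          simp_rw [← mul_sum]
      _ ≤ ∑ A ∈ 𝒜', ((#V).choose m : ℝ) * (((m : ℝ) / #V) ^ k.choose 2 * (1 + k * 2 ^ k * b ^ k.choose 2)) :=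
          sum_le_sum fun A hA => mul_le_mul_of_nonneg_left
            (fcl_sum_pow_card_union_le hk hn hq0 hb hqb (h𝒜' A hA).1 𝒜' fun B hB => (h𝒜' B hB).1)
            (Nat.cast_nonneg _)
      _ = _ := by
          rw [sum_const, nsmul_eq_mul]
          ring
  calc _ = (∑ A ∈ 𝒜', (#((V.powersetCard m).filter fun y =>
        (univ.filter fun e : Edge n => cliqueVec A e = true) ⊆ y) : ℝ)) ^ 2 := by rw [hsum1]
    _ ≤ _ := h3
    _ ≤ _ := mul_le_mul_of_nonneg_left hsum2 (Nat.cast_nonneg _)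

/-- Pure arithmetic of the second-moment method: from `(A'L)² ≤ P₁·A'C₀q^K·Mb`, `C₀a'^K ≤ L`, `p/2 ≤ a'`, `q ≤ 4p`, `c₀ ≤ A'p^K` conclude `c₀ (1/2)^{2K} / (4^K Mb) · C₀ ≤ P₁`. [folklore] -/
theorem fcl_density {A' C₀ L P₁ p q c₀ Mb a' : ℝ} {K : ℕ}
    (hmom : (A' * L) ^ 2 ≤ P₁ * (A' * C₀ * (q ^ K * Mb))) (hL : C₀ * a' ^ K ≤ L) (ha' : p / 2 ≤ a')
    (hq : q ≤ 4 * p) (hcount : c₀ ≤ A' * p ^ K) (hA : 0 ≤ A') (hC : 0 ≤ C₀) (hP : 0 ≤ P₁) (hp : 0 < p)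
    (hMb : 0 < Mb) (hc₀ : 0 < c₀) (hq0 : 0 ≤ q) :
    c₀ * (1 / 2) ^ (2 * K) / (4 ^ K * Mb) * C₀ ≤ P₁ := by
  have hA0 : 0 < A' := by
    rcases hA.eq_or_lt with h | h
    · rw [← h, zero_mul] at hcount
      exact absurd hcount (not_le.2 hc₀)
    · exact h
  rcases hC.eq_or_lt with h | hC0
  · rw [← h, mul_zero]
    exact hP
  have h4M : 0 < (4 : ℝ) ^ K * Mb := mul_pos (pow_pos four_pos K) hMb
  have hkey : A' * C₀ * (1 / 2) ^ (2 * K) * p ^ K ≤ P₁ * 4 ^ K * Mb := by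
    have h1 : C₀ * (p / 2) ^ K ≤ L :=
      le_trans (mul_le_mul_of_nonneg_left (pow_le_pow_left₀ (by positivity) ha' K) hC) hL
    have h := calc (A' * C₀ * (1 / 2) ^ (2 * K) * p ^ K) * (A' * C₀ * p ^ K)
          = (A' * (C₀ * (p / 2) ^ K)) ^ 2 := by ring
        _ ≤ (A' * L) ^ 2 := pow_le_pow_left₀ (by positivity) (mul_le_mul_of_nonneg_left h1 hA) 2
        _ ≤ P₁ * (A' * C₀ * (q ^ K * Mb)) := hmom
        _ ≤ P₁ * (A' * C₀ * ((4 * p) ^ K * Mb)) :=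
          mul_le_mul_of_nonneg_left (mul_le_mul_of_nonneg_left
            (mul_le_mul_of_nonneg_right (pow_le_pow_left₀ hq0 hq K) hMb.le) (mul_nonneg hA hC)) hP
        _ = (P₁ * 4 ^ K * Mb) * (A' * C₀ * p ^ K) := by ring
    exact le_of_mul_le_mul_right h (by positivity)
  calc c₀ * (1 / 2) ^ (2 * K) / (4 ^ K * Mb) * C₀
      ≤ (A' * p ^ K) * (1 / 2) ^ (2 * K) / (4 ^ K * Mb) * C₀ :=
        mul_le_mul_of_nonneg_right (div_le_div_of_nonneg_right
          (mul_le_mul_of_nonneg_right hcount (by positivity)) h4M.le) hC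
    _ = (A' * C₀ * (1 / 2) ^ (2 * K) * p ^ K) / (4 ^ K * Mb) := by ring
    _ ≤ (P₁ * 4 ^ K * Mb) / (4 ^ K * Mb) := div_le_div_of_nonneg_right hkey h4M.le
    _ = P₁ := by field_simp

/-- **The fibre bound.** On the fibre of slice `j` over a read set `F` with pattern `ρ`, if `𝒜'` is a family of `k`-sets with clique edges off `F` and `#𝒜'·p^K ≥ c₀`, and the free part of the fibre is a layer of density in `[p/2, 4p]` of `Fᶜ`, then at least a `c₀(1/2)^{2K}/(4^K(1 + k2^k4^K))`-fraction of the fibre has a `k`-clique AVOIDING `F` (transport to the layer `fcl_card_fibre_filter`, then `fcl_layer_bound` + `fcl_density`). [folklore] -/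
theorem fcl_fibre_bound {n k j : ℕ} (hk : 2 ≤ k) (hn : 1 ≤ n) (F : Finset (Edge n)) (ρ : Edge n → Bool)
    (𝒜' : Finset (Finset (Fin n)))
    (h𝒜' : ∀ A ∈ 𝒜', A ∈ powersetCard k (univ : Finset (Fin n)) ∧
      (univ.filter fun e : Edge n => cliqueVec A e = true) ⊆ univ \ F)
    {c₀ : ℝ} (hc₀ : 0 < c₀) (hcount : c₀ ≤ #𝒜' * pc n k ^ k.choose 2)
    (hwin : ∀ r : ℕ, r ≤ #F → r ≤ j →
      pc n k / 2 ≤ (((j - r : ℕ) : ℝ) + 1 - k.choose 2) / #((univ : Finset (Edge n)) \ F) ∧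
      ((j - r : ℕ) : ℝ) / #((univ : Finset (Edge n)) \ F) ≤ 4 * pc n k)
    (hV : 0 < #((univ : Finset (Edge n)) \ F)) (hp : 0 < pc n k) :
    c₀ * (1 / 2) ^ (2 * k.choose 2) / (4 ^ k.choose 2 * (1 + k * 2 ^ k * (4 : ℝ) ^ k.choose 2)) *
        #((slice n j).filter fun x => ∀ e ∈ F, x e = ρ e) ≤
      #((slice n j).filter fun x => (∀ e ∈ F, x e = ρ e) ∧ cliqueFn n k (zeroOn F x) = true) := by
  -- the target set is a filter of the fibre
  have hset : ((slice n j).filter fun x => (∀ e ∈ F, x e = ρ e) ∧ cliqueFn n k (zeroOn F x) = true) =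
      ((slice n j).filter fun x => ∀ e ∈ F, x e = ρ e).filter fun x => cliqueFn n k (zeroOn F x) = true :=
    (filter_filter _ _ _).symm
  rw [hset]
  -- degenerate fibres: more ones prescribed on `F` than edges
  by_cases hr : #(F.filter fun e => ρ e = true) ≤ j
  swap
  · have hΦ0 : ((slice n j).filter fun x => ∀ e ∈ F, x e = ρ e) = ∅ := by
      refine filter_eq_empty_iff.2 fun x hx hxF => hr ?_
      have hsub : (F.filter fun e => ρ e = true) ⊆ esupp x := fun e he => by
        rw [mem_filter] at he
        exact Theorems.SliceACZero.Negative.mem_supp.2 ((hxF e he.1).trans he.2)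
      have h := card_le_card hsub
      rwa [card_supp, (mem_filter.1 hx).2] at h
    rw [hΦ0, filter_empty, card_empty, Nat.cast_zero, mul_zero]
  -- transport: the fibre is the layer `j - r` of `Fᶜ`
  have hcardΦ : #((slice n j).filter fun x => ∀ e ∈ F, x e = ρ e) =
      #((univ \ F).powersetCard (j - #(F.filter fun e => ρ e = true))) := by
    have h := fcl_card_fibre_filter F ρ (fun _ => True) hr
    rwa [filter_true_of_mem fun _ _ => trivial, filter_true_of_mem fun _ _ => trivial] at h
  -- transport: a clique of `𝒜'` inside `supp x ∖ F` is a clique of `x ∖ F`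
  have hclique : #(((univ \ F).powersetCard (j - #(F.filter fun e => ρ e = true))).filter fun y =>
        ∃ A ∈ 𝒜', (univ.filter fun e : Edge n => cliqueVec A e = true) ⊆ y) ≤
      #(((slice n j).filter fun x => ∀ e ∈ F, x e = ρ e).filter fun x => cliqueFn n k (zeroOn F x) = true) := by
    rw [← fcl_card_fibre_filter F ρ
      (fun y => ∃ A ∈ 𝒜', (univ.filter fun e : Edge n => cliqueVec A e = true) ⊆ y) hr]
    refine card_le_card fun x hx => ?_
    rw [mem_filter] at hx ⊢
    obtain ⟨hxΦ, A, hA, hAx⟩ := hx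
    refine ⟨hxΦ, ?_⟩
    rw [← cliqueCount_ne_zero_iff, Ne, cliqueCount_eq_zero_iff_forall]
    intro hno
    refine hno A (h𝒜' A hA).1 fun e he => ?_
    have he' := hAx (mem_filter.2 ⟨mem_univ _, he⟩)
    rw [Finset.mem_sdiff, Theorems.SliceACZero.Negative.mem_supp] at he'
    unfold zeroOn
    rw [if_neg he'.2]
    exact he'.1
  -- degenerate layers: empty
  by_cases hmV : j - #(F.filter fun e => ρ e = true) ≤ #(univ \ F)
  swap
  · rw [hcardΦ, powersetCard_eq_empty.2 (not_le.1 hmV), card_empty, Nat.cast_zero, mul_zero]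
    exact Nat.cast_nonneg _
  -- the window at `r = #R`
  obtain ⟨ha', hq⟩ := hwin _ (card_filter_le _ _) hr
  have hV' : (0 : ℝ) < #(univ \ F) := by exact_mod_cast hV
  have hKm : k.choose 2 ≤ j - #(F.filter fun e => ρ e = true) := by
    have h1 := lt_of_lt_of_le (by positivity : (0 : ℝ) < pc n k / 2) ha'
    have h2 : 0 < ((j - #(F.filter fun e => ρ e = true) : ℕ) : ℝ) + 1 - k.choose 2 := by
      by_contra hle
      exact absurd (div_nonpos_of_nonpos_of_nonneg (not_lt.1 hle) hV'.le) (not_le.2 h1)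
    have h3 : k.choose 2 < j - #(F.filter fun e => ρ e = true) + 1 := by
      exact_mod_cast (show (k.choose 2 : ℝ) < ((j - #(F.filter fun e => ρ e = true) : ℕ) : ℝ) + 1 by
        linarith)
    omega
  -- second moment on the layer, ratio bounds, arithmetic
  have hmom := fcl_layer_bound hk hn (univ \ F) 𝒜' h𝒜' hV hKm (b := 4) (by norm_num) hq
  have hL := fcl_choose_mul_pow_le_choose_sub hKm hV
  have hdens := fcl_density hmom hL ha' hq hcount (Nat.cast_nonneg _) (Nat.cast_nonneg _)
    (Nat.cast_nonneg _) hp (by positivity) hc₀ (by positivity)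
  rw [hcardΦ, card_powersetCard]
  exact hdens.trans (by exact_mod_cast hclique)

/-- `n · n^{-2/(k-1)} → ∞` for `k ≥ 4`. [folklore] -/
theorem fcl_tendsto_mul_pc {k : ℕ} (hk : 4 ≤ k) : Tendsto (fun n : ℕ => (n : ℝ) * pc n k) atTop atTop := by
  have hk' : (4 : ℝ) ≤ k := by exact_mod_cast hk
  have hpos : 0 < 1 - (2 : ℝ) / ((k : ℝ) - 1) := by
    rw [sub_pos, div_lt_one (by linarith)]
    linarith
  refine ((tendsto_rpow_atTop hpos).comp tendsto_natCast_atTop_atTop).congr' ?_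
  filter_upwards [eventually_gt_atTop 0] with n hn
  have hn0 : (0 : ℝ) < n := by exact_mod_cast hn
  simp only [Function.comp_apply, pc]
  rw [Real.rpow_sub hn0, Real.rpow_one, neg_div, Real.rpow_neg hn0.le, div_eq_mul_inv]

/-- Window bookkeeping: eventually `T = C(n,2)·p ≥ 1` and every central `j` lies in `[3T/4, 2T]`. [folklore] -/
theorem fcl_window {k : ℕ} (hk : 3 ≤ k) :
    ∀ᶠ n : ℕ in atTop, 1 ≤ ((n.choose 2 : ℕ) : ℝ) * pc n k ∧ ∀ j : ℕ, Central k n j →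
      3 / 4 * (((n.choose 2 : ℕ) : ℝ) * pc n k) ≤ j ∧ (j : ℝ) ≤ 2 * (((n.choose 2 : ℕ) : ℝ) * pc n k) := by
  obtain ⟨T, hTdef⟩ : ∃ T : ℕ → ℝ, ∀ n : ℕ,
      T n = ((n.choose 2 : ℕ) : ℝ) * (n : ℝ) ^ (-(2 : ℝ) / ((k : ℝ) - 1)) := ⟨_, fun _ => rfl⟩
  have hT : Tendsto T atTop atTop := (ts_tendsto_T hk).congr fun n => (hTdef n).symm
  have e1 : ∀ᶠ n : ℕ in atTop, (3 / 4 : ℝ) < 1 - (T n) ^ (-(1 / 4 : ℝ)) - 1 / T n :=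
    (tendsto_order.1 (ts_tendsto_lower hT)).1 _ (by norm_num)
  have e2 : ∀ᶠ n : ℕ in atTop, 1 + (T n) ^ (-(1 / 4 : ℝ)) + ((0 : ℕ) : ℝ) / T n < 2 :=
    (tendsto_order.1 (ts_tendsto_upper hT 0)).2 _ (by norm_num)
  have e3 : ∀ᶠ n : ℕ in atTop, 1 ≤ T n := hT.eventually_ge_atTop 1
  filter_upwards [e1, e2, e3] with n h1 h2 h3
  have hTn : T n = ((n.choose 2 : ℕ) : ℝ) * pc n k := hTdef n
  have hT0 : 0 < T n := by linarith
  rw [← hTn]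
  refine ⟨h3, fun j hj => ?_⟩
  have hj' := ts_central_iff.1 hj
  rw [← hTdef n] at hj'
  constructor
  · calc 3 / 4 * T n = T n * (3 / 4) := mul_comm _ _
      _ ≤ T n * (1 - (T n) ^ (-(1 / 4 : ℝ)) - 1 / T n) := mul_le_mul_of_nonneg_left h1.le hT0.le
      _ ≤ j := ts_T_mul_lower_le hT0 hj'
  · calc (j : ℝ) ≤ T n * (1 + (T n) ^ (-(1 / 4 : ℝ)) + ((0 : ℕ) : ℝ) / T n) :=
          ts_le_T_mul_upper hT0 hj' (Nat.le_add_right j 0)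
      _ ≤ T n * 2 := mul_le_mul_of_nonneg_left h2.le hT0.le
      _ = 2 * T n := mul_comm _ _

/-- **stub T3 `stub_fibreCliqueLower`** of line `Sketch-ideator3-r1` (crux stmt-PneNP-2832): for `k ≥ 4` there is `α > 0` such that eventually, on every central slice `j`, for every slot set `F` with `#F ≤ 3n` and every pattern `ρ`, at least an `α`-fraction of the fibre `{x ∈ slice_j : x|_F = ρ|_F}` has a `k`-clique avoiding `F`: the `k`-sets with no clique edge in `F` number `≥ C(n,k) − 3n·C(n−2,k−2) ≥ C(n,k)/2`, the free part of the fibre is a near-critical layer of `Fᶜ` (`#F ≤ 3n = o(m_k(n))` needs `k ≥ 4`; both guards are load-bearing, Disproof.lean §6), and `fcl_fibre_bound` applies. [folklore] -/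
theorem stub_fibreCliqueLower :
    ∀ k : ℕ, 4 ≤ k → ∃ α : ℝ, 0 < α ∧ ∀ᶠ n : ℕ in atTop, ∀ j : ℕ, Central k n j →
      ∀ F : Finset (Edge n), #F ≤ 3 * n → ∀ ρ : Edge n → Bool,
        α * #((slice n j).filter fun x => ∀ e ∈ F, x e = ρ e) ≤
          #((slice n j).filter fun x => (∀ e ∈ F, x e = ρ e) ∧ cliqueFn n k (zeroOn F x) = true) := by
  intro k hk
  have hk2 : 2 ≤ k := by omega
  have hc₀0 : (0 : ℝ) < 1 / (2 ^ (k + 1) * k.factorial) := by positivity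
  refine ⟨1 / (2 ^ (k + 1) * k.factorial) * (1 / 2) ^ (2 * k.choose 2) /
    (4 ^ k.choose 2 * (1 + k * 2 ^ k * (4 : ℝ) ^ k.choose 2)), by positivity, ?_⟩
  have E1 : ∀ᶠ n : ℕ in atTop, 48 ≤ (n : ℝ) * pc n k := (fcl_tendsto_mul_pc hk).eventually_ge_atTop 48
  have E3 : ∀ᶠ n : ℕ in atTop, (3 : ℝ) / n ≤ 1 / (2 ^ (k + 1) * k.factorial) :=
    (tendsto_const_div_atTop_nhds_zero_nat 3).eventually (eventually_le_nhds hc₀0)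
  filter_upwards [E1, fcl_window (k := k) (by omega), E3, eventually_ge_atTop (2 * k + 13),
    eventually_ge_atTop (k.choose 2 + 3)] with n h48 hwin h3n hn hnK
  obtain ⟨-, hwin⟩ := hwin
  intro j hj F hF ρ
  have hn1 : 1 ≤ n := by omega
  have hn1r : (1 : ℝ) ≤ n := by exact_mod_cast hn1
  have hp0 : 0 < pc n k := Real.rpow_pos_of_pos (by linarith) _
  -- `C(n,2)` versus `n` and `#F`
  have hN : ((n.choose 2 : ℕ) : ℝ) = n * (n - 1) / 2 := Nat.cast_choose_two ℝ n
  have hN6 : 6 * (n : ℝ) ≤ (n.choose 2 : ℕ) := by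
    have h13 : (13 : ℝ) ≤ n := by exact_mod_cast (show 13 ≤ n by omega)
    rw [hN]
    nlinarith [mul_nonneg (by linarith : (0 : ℝ) ≤ n) (sub_nonneg.2 h13)]
  have hN6' : 6 * n ≤ n.choose 2 := by exact_mod_cast hN6
  have hcardV : #((univ : Finset (Edge n)) \ F) = n.choose 2 - #F := by
    rw [card_sdiff_of_subset (subset_univ F), card_univ, card_edgeSet_top_fin]
  have hV : 0 < #((univ : Finset (Edge n)) \ F) := by
    rw [hcardV]
    omega
  have hFr : (#F : ℝ) ≤ 3 * n := by exact_mod_cast hF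
  have hVr : ((n.choose 2 : ℕ) : ℝ) / 2 ≤ #((univ : Finset (Edge n)) \ F) := by
    rw [hcardV, Nat.cast_sub (by omega)]
    linarith
  have hVle : (#((univ : Finset (Edge n)) \ F) : ℝ) ≤ (n.choose 2 : ℕ) := by
    exact_mod_cast (hcardV ▸ Nat.sub_le _ _ : #((univ : Finset (Edge n)) \ F) ≤ n.choose 2)
  -- `T = C(n,2)·p ≥ 12n + 4K + 4`
  have hT : 12 * (n : ℝ) + 4 * k.choose 2 + 4 ≤ ((n.choose 2 : ℕ) : ℝ) * pc n k := by
    have h1 : ((n.choose 2 : ℕ) : ℝ) * pc n k = ((n : ℝ) - 1) / 2 * ((n : ℝ) * pc n k) := by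
      rw [hN]
      ring
    have h2 : (k.choose 2 : ℝ) + 3 ≤ n := by exact_mod_cast hnK
    have h3 : ((n : ℝ) - 1) / 2 * 48 ≤ ((n : ℝ) - 1) / 2 * ((n : ℝ) * pc n k) :=
      mul_le_mul_of_nonneg_left h48 (by linarith)
    rw [h1]
    linarith
  -- the window facts for the sub-slices `j - r`, `r ≤ #F ≤ 3n`
  have hwin' : ∀ r : ℕ, r ≤ #F → r ≤ j →
      pc n k / 2 ≤ (((j - r : ℕ) : ℝ) + 1 - k.choose 2) / #((univ : Finset (Edge n)) \ F) ∧
      ((j - r : ℕ) : ℝ) / #((univ : Finset (Edge n)) \ F) ≤ 4 * pc n k := by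
    intro r hrF hrj
    obtain ⟨hjlo, hjhi⟩ := hwin j hj
    have hV0 : (0 : ℝ) < #((univ : Finset (Edge n)) \ F) := by exact_mod_cast hV
    have hr3 : (r : ℝ) ≤ 3 * n := by exact_mod_cast hrF.trans hF
    have hr0 : (0 : ℝ) ≤ r := Nat.cast_nonneg r
    have hjr : ((j - r : ℕ) : ℝ) = j - r := by rw [Nat.cast_sub hrj]
    constructor
    · rw [le_div_iff₀ hV0, hjr]
      have h5 : pc n k / 2 * #((univ : Finset (Edge n)) \ F) ≤ pc n k / 2 * (n.choose 2 : ℕ) :=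
        mul_le_mul_of_nonneg_left hVle (by positivity)
      have h6 : pc n k / 2 * ((n.choose 2 : ℕ) : ℝ) = ((n.choose 2 : ℕ) : ℝ) * pc n k / 2 := by ring
      linarith
    · rw [div_le_iff₀ hV0, hjr]
      have h7 : 4 * pc n k * (((n.choose 2 : ℕ) : ℝ) / 2) ≤ 4 * pc n k * #((univ : Finset (Edge n)) \ F) :=
        mul_le_mul_of_nonneg_left hVr (by positivity)
      have h8 : 4 * pc n k * (((n.choose 2 : ℕ) : ℝ) / 2) = 2 * (((n.choose 2 : ℕ) : ℝ) * pc n k) := by ring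
      linarith
  -- the `F`-avoiding `k`-sets are numerous: `#𝒜'·p^K ≥ 1/(2^k k!) - 3/n ≥ c₀`
  have hcount : 1 / (2 ^ (k + 1) * k.factorial) ≤
      #((powersetCard k (univ : Finset (Fin n))).filter fun A =>
        (univ.filter fun e : Edge n => cliqueVec A e = true) ⊆ univ \ F) * pc n k ^ k.choose 2 := by
    have h1 : (n.choose k : ℝ) ≤ #((powersetCard k (univ : Finset (Fin n))).filter fun A =>
        (univ.filter fun e : Edge n => cliqueVec A e = true) ⊆ univ \ F) + #F * ((n - 2).choose (k - 2) : ℝ) := by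
      exact_mod_cast fcl_choose_le_card_avoiding_add (k := k) F
    have h2 : 1 / (2 ^ k * k.factorial : ℝ) ≤ (n.choose k : ℝ) * pc n k ^ k.choose 2 := by
      have := le_choose_mul_threshold_pow hk2 (by omega : 2 * k ≤ n) (a := (1 : ℝ)) zero_le_one
      simpa only [one_pow, one_mul, pc] using this
    have h3 : (#F : ℝ) * ((n - 2).choose (k - 2) : ℝ) * pc n k ^ k.choose 2 ≤ 3 / n := by
      rw [pc_pow_choose hn1 hk2]
      have ha : ((n - 2).choose (k - 2) : ℝ) ≤ (n : ℝ) ^ (k - 2) := by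
        have h₁ : (n - 2).choose (k - 2) ≤ (n - 2) ^ (k - 2) := Nat.choose_le_pow _ _
        have h₂ : (n - 2) ^ (k - 2) ≤ n ^ (k - 2) := Nat.pow_le_pow_left (Nat.sub_le n 2) _
        exact_mod_cast h₁.trans h₂
      have hk' : (n : ℝ) ^ k = (n : ℝ) ^ (k - 2) * n * n := by
        rw [← pow_succ, ← pow_succ]
        congr 1
        omega
      have hinv : (0 : ℝ) ≤ ((n : ℝ) ^ k)⁻¹ := by positivity
      calc (#F : ℝ) * ((n - 2).choose (k - 2) : ℝ) * ((n : ℝ) ^ k)⁻¹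
          ≤ (3 * n) * (n : ℝ) ^ (k - 2) * ((n : ℝ) ^ k)⁻¹ := by gcongr
        _ = 3 / n := by
            rw [hk']
            field_simp
    have hpK : 0 ≤ pc n k ^ k.choose 2 := pow_nonneg (pc_nonneg n k) _
    have h4 := calc (n.choose k : ℝ) * pc n k ^ k.choose 2
        ≤ (#((powersetCard k (univ : Finset (Fin n))).filter fun A =>
            (univ.filter fun e : Edge n => cliqueVec A e = true) ⊆ univ \ F) +
            #F * ((n - 2).choose (k - 2) : ℝ)) * pc n k ^ k.choose 2 := mul_le_mul_of_nonneg_right h1 hpK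
      _ = #((powersetCard k (univ : Finset (Fin n))).filter fun A =>
            (univ.filter fun e : Edge n => cliqueVec A e = true) ⊆ univ \ F) * pc n k ^ k.choose 2 +
            (#F : ℝ) * ((n - 2).choose (k - 2) : ℝ) * pc n k ^ k.choose 2 := by ring
    have h5 : 1 / (2 ^ k * k.factorial : ℝ) = 2 * (1 / (2 ^ (k + 1) * k.factorial)) := by
      rw [pow_succ]
      field_simp
    linarith
  exact fcl_fibre_bound hk2 hn1 F ρ _ (fun A hA => mem_filter.1 hA) hc₀0 hcount hwin' hV hp0

end

end Summit.PneNP.PneNP.Cruxes.SliceTarget.Ideator3Line
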